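import Literature.AlgebraicGeometry.HodgeTheory.AbelianVarietyFixedPointsDivisibilityPeriodicity
import Literature.Dynamics.FixedPoints.LeastPeriodCounts
import HarnessLib

/-!
# Closed orbits of an algebraic self-map of a complex abelian variety: the points of `A(ℂ)` of least
# `f(ℂ)`-period `n`, `L(n) = Σ_{d ∣ n} μ(n/d) det(1 - (f(ℂ)^*)^d | H¹(A(ℂ); ℚ))`, and the Dold congruences

Lane `lit-hodgefound`, row A1-30⁺¹⁵ / (A1-30⁺¹⁴)⁺ / (Q630)⁺ (prover seat `lit-hodgefound-p31`; FILE B of the row whose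
FILE A is the general-dynamics file `Dynamics/FixedPoints/LeastPeriodCounts.lean` (Byszewski–Graff–Ward 2021
Lemma 3.4: `Fix_T(n) = Σ_{d ∣ n} L_T(d)`, `n ∣ L_T(n)`, `L_T(n) = Σ_{d ∣ n} μ(n/d) Fix_T(d)`), applied to
`T = f(ℂ)` and joined to `#Fix(f(ℂ)^[n]) = det(1 - (f(ℂ)^*)ⁿ | H¹(A(ℂ); ℚ))` (`AbelianVarietyFixedPointsFiniteness.lean`,
row Q630) and to the finiteness criterion «no eigenvalue is an `n`-th root of unity»
(`AbelianVarietyFixedPointsDivisibilityPeriodicity.lean`, row A1-30⁺¹⁴)).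

Printed statements.  J. Byszewski, G. Graff, T. Ward, *Dold sequences, periodic points, and dynamics*, Bull.
London Math. Soc. 53 (2021) (held `paper:arxiv-2007.04031`): §3.1 (chunk p0008) «We also write `L_T(n)` for the
number of points in `F_T(n)` with least period `n`, so `n O_T(n) = L_T(n)`» (`O_T(n)` the number of closed orbits
of length `n`), **Lemma 3.4** (chunk p0008) «Let `T : X → X` be a map. Then `Fix_T(n) = Σ_{d|n} d O_T(d)` and so
`O_T(n) = (1/n) Σ_{d|n} μ(n/d) Fix_T(d)`», **Definition 2.1** (chunk p0004) «`(a_n)` is called a Dold sequence if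
`Σ_{d|n} μ(n/d) a_d ≡ 0` modulo `n` for all `n ≥ 1`», §2 (chunk p0004) «If `A ∈ M_{m,m}(ℤ)` is an integer matrix,
then the sequence `(trace Aⁿ)` is a Dold sequence», §4.1 (chunk p0010) «a realizable sequence is a Dold
sequence»; G. Everest, T. Ward, *Heights of Polynomials and Entropy in Algebraic Dynamics* (1999), Ch. 2
Lemma 2.3 (chunk p0031) «`|Per_n(T_A)| = |det(Aⁿ - I)| = |Δ_n(χ_A)|` if `T_A` is ergodic» and «`T_A` is ergodic if
and only if `Per_n(T_A)` is finite for every `n`»; M. Alvarado, R. Auffarth (2018), p0003: `F(n) := #Fix(fⁿ)`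
(«the number of fixed points of `fⁿ` if this number is finite, and `0` if not»).

For a complex abelian variety `A` (`Motives.AbelianVariety ℂ`) and a `ℂ`-morphism `f : A.X ⟶ A.X` write
`T := f(ℂ)^*` on `H¹(A(ℂ); ℚ)`, `F(n) := Nat.card (Fix(f(ℂ)^[n]))`, `L(n) := Nat.card {x ∈ A(ℂ) | x has least
f(ℂ)-period n}` (Mathlib's `Function.minimalPeriod`).  This file proves (theorems only; no definition, no named
fact): `AbelianVariety.dvd_natCard_minimalPeriod` (`n ∣ L(n)`),
**`AbelianVariety.natCard_fixedPoints_iterate_eq_sum_natCard_minimalPeriod`** (`F(n) = Σ_{d ∣ n} L(d)` when no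
eigenvalue of `T` is an `n`-th root of unity), **`AbelianVariety.sum_moebius_mul_det_one_sub_pow_eq_natCard_minimalPeriod`**
(`Σ_{d ∣ n} μ(n/d) det(1 - T^d) = L(n)`), `AbelianVariety.sum_moebius_mul_prod_one_sub_pow_eigenvalues_eq_natCard_minimalPeriod`
(the same over the eigenvalues: `Σ_{d ∣ n} μ(n/d) ∏ᵢ (1 - αᵢ^d) = L(n)`),
**`AbelianVariety.exists_sum_moebius_mul_det_one_sub_pow_eq_mul`** (the Dold congruence for the determinants:
`Σ_{d ∣ n} μ(n/d) det(1 - T^d) = n · O(n)` with `O(n) ∈ ℕ` the number of closed `f(ℂ)`-orbits of length `n`),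
`AbelianVariety.dvd_sum_moebius_mul_natCard_fixedPoints_iterate` (`n ∣ Σ_{d ∣ n} μ(n/d) F(d)` whenever
`Fix(f(ℂ)^[n])` is finite) and **`AbelianVariety.dold_natCard_fixedPoints_iterate`** (`(F(n))_{n ≥ 1}` is a Dold
sequence when no eigenvalue of `T` is a root of unity — Everest–Ward's ergodic case).

## References

* [ByszewskiGraffWard2021] J. Byszewski, G. Graff, T. Ward, *Dold sequences, periodic points, and dynamics*,
  Bull. London Math. Soc. 53 (2021) 1263–1298, Def. 2.1, §2, §3.1, Lemma 3.4, §4.1 (held text chunks p0004, p0008, p0010).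
* [EverestWard1999] G. Everest, T. Ward, *Heights of Polynomials and Entropy in Algebraic Dynamics* (1999), Ch. 2
  Lemma 2.3 (held text chunks p0030–p0031).
* [AlvaradoAuffarth2018] M. Alvarado, R. Auffarth, *Fixed points of endomorphisms of complex tori*, J. Algebra
  507 (2018), §1 (arXiv PDF p. 3).
-/

noncomputable section

open CategoryTheory Module Function Finset
open Literature.AlgebraicTopology.SingularHomology Literature.NumberTheory.LFunctions Literature.Dynamics.FixedPoints
open Literature.AlgebraicGeometry.Motives (ComplexPoints AbelianVariety AlgPoints)

namespace Literature.AlgebraicGeometry.HodgeTheory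

section Headlines

variable (A : AbelianVariety ℂ) (f : A.X ⟶ A.X)

/-- **`n ∣ L(n)`**: the number of points of `A(ℂ)` of least `f(ℂ)`-period `n ≥ 1` is a multiple of `n` (they split
into closed orbits of length `n`; «`n O_T(n) = L_T(n)`»; as `Nat.card`, an infinite set counting `0`).
[cite: ByszewskiGraffWard2021, §3.1 (text chunk p0008)] -/
theorem AbelianVariety.dvd_natCard_minimalPeriod {n : ℕ} (hn : 0 < n) :
    n ∣ Nat.card {x : ComplexPoints A.X | minimalPeriod (AlgPoints.mapContinuous (L := ℂ) f) x = n} :=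
  dvd_natCard_setOf_minimalPeriod_eq _ hn

/-- **`F(n) = Σ_{d ∣ n} L(d)`** when no eigenvalue of `f(ℂ)^*` on `H¹(A(ℂ); ℚ)` is an `n`-th root of unity
(then `Fix(f(ℂ)^[n])` is finite and non-empty, row A1-30⁺¹⁴, and «`F_T(n)` is the disjoint union of these closed
orbits»). [cite: ByszewskiGraffWard2021, Lemma 3.4 (text chunk p0008)] [cite: EverestWard1999, Ch. 2 Lemma 2.3 (text chunk p0031)] -/
theorem AbelianVariety.natCard_fixedPoints_iterate_eq_sum_natCard_minimalPeriod {n : ℕ} (hn : 0 < n)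
    (hα : ∀ α ∈ FrobeniusCharpoly.eigenvalues ℂ (singularCohomology.map ℚ ℚ (AlgPoints.mapContinuous (L := ℂ) f) 1).hom,
      α ^ n ≠ 1) :
    Nat.card (fixedPoints (AlgPoints.mapContinuous (L := ℂ) f)^[n]) =
      ∑ d ∈ n.divisors,
        Nat.card {x : ComplexPoints A.X | minimalPeriod (AlgPoints.mapContinuous (L := ℂ) f) x = d} :=
  natCard_fixedPoints_iterate_eq_sum _ hn
    ((AbelianVariety.finite_and_nonempty_fixedPoints_iterate_iff_forall_eigenvalue A f n).2 hα).1

/-- **`n ∣ Σ_{d ∣ n} μ(n/d) F(d)`** whenever `Fix(f(ℂ)^[n])` is finite, `n ≥ 1` (the sum is `L(n) = n O(n)`;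
Lemma 3.4 for `T = f(ℂ)`). [cite: ByszewskiGraffWard2021, Lemma 3.4 and Def. 2.1 (text chunks p0008, p0004)] -/
theorem AbelianVariety.dvd_sum_moebius_mul_natCard_fixedPoints_iterate {n : ℕ} (hn : 0 < n)
    (hfin : (fixedPoints (AlgPoints.mapContinuous (L := ℂ) f)^[n]).Finite) :
    (n : ℤ) ∣ ∑ d ∈ n.divisors, (ArithmeticFunction.moebius (n / d) : ℤ) *
      (Nat.card (fixedPoints (AlgPoints.mapContinuous (L := ℂ) f)^[d]) : ℤ) :=
  Literature.Dynamics.FixedPoints.dvd_sum_moebius_mul_natCard_fixedPoints_iterate _ hn hfin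

/-- **`Σ_{d ∣ n} μ(n/d) det(1 - (f(ℂ)^*)^d | H¹(A(ℂ); ℚ)) = L(n)`**, the number of points of `A(ℂ)` of least
`f(ℂ)`-period `n`, whenever no eigenvalue of `f(ℂ)^*` on `H¹(A(ℂ); ℚ)` is an `n`-th root of unity (`n ≥ 1`):
Lemma 3.4's «`O_T(n) = (1/n) Σ_{d|n} μ(n/d) Fix_T(d)`» times `n`, with `Fix_{f(ℂ)}(d) = det(1 - (f(ℂ)^*)^d)` (row
Q630) — «`|Per_n(T_A)| = |det(Aⁿ - I)|` if `T_A` is ergodic». [cite: ByszewskiGraffWard2021, Lemma 3.4 (text chunk p0008)]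
[cite: EverestWard1999, Ch. 2 Lemma 2.3 (text chunk p0031)] -/
theorem AbelianVariety.sum_moebius_mul_det_one_sub_pow_eq_natCard_minimalPeriod {n : ℕ} (hn : 0 < n)
    (hα : ∀ α ∈ FrobeniusCharpoly.eigenvalues ℂ (singularCohomology.map ℚ ℚ (AlgPoints.mapContinuous (L := ℂ) f) 1).hom,
      α ^ n ≠ 1) :
    ∑ d ∈ n.divisors, (ArithmeticFunction.moebius (n / d) : ℚ) *
        LinearMap.det (1 - (singularCohomology.map ℚ ℚ (AlgPoints.mapContinuous (L := ℂ) f) 1).hom ^ d) =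
      Nat.card {x : ComplexPoints A.X | minimalPeriod (AlgPoints.mapContinuous (L := ℂ) f) x = n} := by
  have hfin := ((AbelianVariety.finite_and_nonempty_fixedPoints_iterate_iff_forall_eigenvalue A f n).2 hα).1
  have hZ := sum_moebius_mul_natCard_fixedPoints_iterate_eq _ hn hfin
  have hQ : ∑ d ∈ n.divisors, (ArithmeticFunction.moebius (n / d) : ℚ) *
      (Nat.card (fixedPoints (AlgPoints.mapContinuous (L := ℂ) f)^[d]) : ℚ) =
        Nat.card {x : ComplexPoints A.X | minimalPeriod (AlgPoints.mapContinuous (L := ℂ) f) x = n} := by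
    exact_mod_cast hZ
  rw [← hQ]
  refine sum_congr rfl fun d _ ↦ ?_
  rw [AbelianVariety.natCard_fixedPoints_iterate_eq_det_one_sub_pow]

/-- **`Σ_{d ∣ n} μ(n/d) ∏ᵢ (1 - αᵢ^d) = L(n)`** in `ℂ`, over the `2g` eigenvalues `αᵢ` of `f(ℂ)^*` on
`H¹(A(ℂ); ℚ)`, whenever none of them is an `n`-th root of unity (`n ≥ 1`; `Fix(d) = Δ_d = ∏ᵢ (1 - αᵢ^d)`, row A1-30⁺¹³).
[cite: ByszewskiGraffWard2021, Lemma 3.4 (text chunk p0008)] [cite: AlvaradoAuffarth2018, §1 eq. (1) and §3 (arXiv PDF pp. 3, 6)] -/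
theorem AbelianVariety.sum_moebius_mul_prod_one_sub_pow_eigenvalues_eq_natCard_minimalPeriod {n : ℕ} (hn : 0 < n)
    (hα : ∀ α ∈ FrobeniusCharpoly.eigenvalues ℂ (singularCohomology.map ℚ ℚ (AlgPoints.mapContinuous (L := ℂ) f) 1).hom,
      α ^ n ≠ 1) :
    ∑ d ∈ n.divisors, (ArithmeticFunction.moebius (n / d) : ℂ) *
        ((FrobeniusCharpoly.eigenvalues ℂ
          (singularCohomology.map ℚ ℚ (AlgPoints.mapContinuous (L := ℂ) f) 1).hom).map fun α ↦ 1 - α ^ d).prod =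
      Nat.card {x : ComplexPoints A.X | minimalPeriod (AlgPoints.mapContinuous (L := ℂ) f) x = n} := by
  have hfin := ((AbelianVariety.finite_and_nonempty_fixedPoints_iterate_iff_forall_eigenvalue A f n).2 hα).1
  have hZ := sum_moebius_mul_natCard_fixedPoints_iterate_eq _ hn hfin
  have hC : ∑ d ∈ n.divisors, (ArithmeticFunction.moebius (n / d) : ℂ) *
      (Nat.card (fixedPoints (AlgPoints.mapContinuous (L := ℂ) f)^[d]) : ℂ) =
        Nat.card {x : ComplexPoints A.X | minimalPeriod (AlgPoints.mapContinuous (L := ℂ) f) x = n} := by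
    exact_mod_cast hZ
  rw [← hC]
  refine sum_congr rfl fun d _ ↦ ?_
  rw [AbelianVariety.natCard_fixedPoints_iterate_eq_prod_one_sub_pow_eigenvalues]

/-- **The Dold congruence for the determinants: `Σ_{d ∣ n} μ(n/d) det(1 - (f(ℂ)^*)^d | H¹(A(ℂ); ℚ)) = n · O(n)`
with `O(n) ∈ ℕ`** (the number of closed `f(ℂ)`-orbits of length exactly `n` on `A(ℂ)`), whenever no eigenvalue of
`f(ℂ)^*` on `H¹(A(ℂ); ℚ)` is an `n`-th root of unity, `n ≥ 1` — «`O_T(n) = (1/n) Σ_{d|n} μ(n/d) Fix_T(d)`» is a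
non-negative integer («a realizable sequence is a Dold sequence»).
[cite: ByszewskiGraffWard2021, Lemma 3.4, Def. 2.1 and §4.1 (text chunks p0008, p0004, p0010)] -/
theorem AbelianVariety.exists_sum_moebius_mul_det_one_sub_pow_eq_mul {n : ℕ} (hn : 0 < n)
    (hα : ∀ α ∈ FrobeniusCharpoly.eigenvalues ℂ (singularCohomology.map ℚ ℚ (AlgPoints.mapContinuous (L := ℂ) f) 1).hom,
      α ^ n ≠ 1) :
    ∃ O : ℕ, ∑ d ∈ n.divisors, (ArithmeticFunction.moebius (n / d) : ℚ) *
        LinearMap.det (1 - (singularCohomology.map ℚ ℚ (AlgPoints.mapContinuous (L := ℂ) f) 1).hom ^ d) = n * O := by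
  obtain ⟨O, hO⟩ := AbelianVariety.dvd_natCard_minimalPeriod A f hn
  exact ⟨O, by rw [AbelianVariety.sum_moebius_mul_det_one_sub_pow_eq_natCard_minimalPeriod A f hn hα, hO, Nat.cast_mul]⟩

/-- **`(F(n))_{n ≥ 1}` is a Dold sequence when no eigenvalue of `f(ℂ)^*` on `H¹(A(ℂ); ℚ)` is a root of unity**:
`Σ_{d ∣ n} μ(n/d) #Fix(f(ℂ)^[d]) ≡ 0 (mod n)` for every `n ≥ 1` (all the `Fix(f(ℂ)^[n])` are then finite — «`T_A` is
ergodic if and only if `Per_n(T_A)` is finite for every `n`» — and «a realizable sequence is a Dold sequence»).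
[cite: ByszewskiGraffWard2021, Def. 2.1 and §4.1 (text chunks p0004, p0010)] [cite: EverestWard1999, Ch. 2 Lemma 2.3 (text chunks p0030–p0031)] -/
theorem AbelianVariety.dold_natCard_fixedPoints_iterate
    (hα : ∀ α ∈ FrobeniusCharpoly.eigenvalues ℂ (singularCohomology.map ℚ ℚ (AlgPoints.mapContinuous (L := ℂ) f) 1).hom,
      ∀ n, 0 < n → α ^ n ≠ 1) {n : ℕ} (hn : 0 < n) :
    (n : ℤ) ∣ ∑ d ∈ n.divisors, (ArithmeticFunction.moebius (n / d) : ℤ) *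
      (Nat.card (fixedPoints (AlgPoints.mapContinuous (L := ℂ) f)^[d]) : ℤ) :=
  Literature.Dynamics.FixedPoints.dold_natCard_fixedPoints_iterate _
    (fun m hm ↦ ((AbelianVariety.forall_finite_and_nonempty_fixedPoints_iterate_iff A f).2 hα m hm).1) hn

/-- **`L(n) ≤ F(n)`** when no eigenvalue is an `n`-th root of unity (the points of least period `n` are among the
fixed points of `f(ℂ)^[n]`, a finite set). [cite: ByszewskiGraffWard2021, §3.1 (text chunk p0008)] -/
theorem AbelianVariety.natCard_minimalPeriod_le_natCard_fixedPoints_iterate {n : ℕ}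
    (hα : ∀ α ∈ FrobeniusCharpoly.eigenvalues ℂ (singularCohomology.map ℚ ℚ (AlgPoints.mapContinuous (L := ℂ) f) 1).hom,
      α ^ n ≠ 1) :
    Nat.card {x : ComplexPoints A.X | minimalPeriod (AlgPoints.mapContinuous (L := ℂ) f) x = n} ≤
      Nat.card (fixedPoints (AlgPoints.mapContinuous (L := ℂ) f)^[n]) :=
  natCard_setOf_minimalPeriod_eq_le _
    ((AbelianVariety.finite_and_nonempty_fixedPoints_iterate_iff_forall_eigenvalue A f n).2 hα).1

end Headlines

end Literature.AlgebraicGeometry.HodgeTheory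

end
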